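import Summits.Ventures.HodgeRepro2.T5FrobeniusGenerates

/-!
# T5CyclotomicFrobenius — «Frob_p = p in (ℤ/n)^×»

Seat p3 of the blind cell `pub-hodge-repro2` (Tier-5 support column for sub-step N2 of
`route/TIER5.md`).  A kernel witness behind the EXAMPLE of row N2.2.5 of `route/T5-N2-route-3.md`
(«`E = ℚ(ζ₇)`: `Frob₂ = 2 ∈ (ℤ/7)^×` has order `3` …») and the identification of `Frob_p` with
`p mod n` used throughout T4A §3.2: for a Galois number field `F/ℚ`, a prime `P` of `𝓞 F` above
`p`, and the arithmetic Frobenius `Frob_P` of `T5FrobeniusGenerates`,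

* an `m`-th root of unity `ζ` with `p ∤ m` is sent EXACTLY to `ζ ^ p` by `Frob_P`
  (`frob_smul_of_pow_eq_one`, `frob_apply_of_isPrimitiveRoot`; Mathlib's
  `IsArithFrobAt.apply_of_pow_eq_one`);
* for the cyclotomic field `F = ℚ(ζ_n)` and `p ∤ n`, under Mathlib's identification
  `Gal(F/ℚ) ≃* (ℤ/n)^×` (`IsCyclotomicExtension.autEquivPow`), `Frob_P ↦ p`
  (`autEquivPow_frob`) — independent of the prime `P` above `p`.

Declaration of README §8(d): this file uses an L-value-free non-vanishing device: NO.
-/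

namespace Summit.Ventures.HodgeRepro2.T5CyclotomicFrobenius

open NumberField Ideal Polynomial
open scoped Pointwise

variable {F : Type*} [Field F] [NumberField F] [IsGalois ℚ F]
  {p : ℕ} (hp : p.Prime) (P : Ideal (𝓞 F)) [P.IsPrime] [P.LiesOver (span {(p : ℤ)})]

omit [NumberField F] [IsGalois ℚ F] [P.IsPrime] in
/-- A natural number `m` with `p ∤ m` is a unit modulo `P`: its image in `𝓞 F` is not in `P`. -/
theorem natCast_notMem_of_not_dvd {m : ℕ} (hm : ¬ p ∣ m) : (m : 𝓞 F) ∉ P := by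
  intro h
  have h' : algebraMap ℤ (𝓞 F) (m : ℤ) ∈ P := by simpa using h
  rw [T5TameCongruence.algebraMap_mem_iff_dvd (p := p) P] at h'
  exact hm (by exact_mod_cast h')

include hp in
/-- **`Frob_P` raises roots of unity of order prime to `p` to the `p`-th power, exactly.**  For
`ζ ∈ 𝓞 F` with `ζ ^ m = 1` and `p ∤ m`: `Frob_P ζ = ζ ^ p`. -/
theorem frob_smul_of_pow_eq_one {ζ : 𝓞 F} {m : ℕ} (hζ : ζ ^ m = 1) (hm : ¬ p ∣ m) :
    T5FrobeniusGenerates.frob hp P • ζ = ζ ^ p := by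
  haveI := T5TameCongruence.isGaloisGroup_gal (F := F)
  have h := (T5FrobeniusGenerates.isArithFrobAt_frob hp P).apply_of_pow_eq_one hζ
    (natCast_notMem_of_not_dvd P hm)
  rw [MulSemiringAction.toAlgHom_apply, ← P.over_def (span {(p : ℤ)}),
    T5FrobeniusGenerates.card_quotient_span] at h
  exact h

include hp in
/-- The same on the field: for a primitive `m`-th root of unity `μ ∈ F` with `p ∤ m`,
`Frob_P μ = μ ^ p`. -/
theorem frob_apply_of_isPrimitiveRoot {μ : F} {m : ℕ} (hμ : IsPrimitiveRoot μ m) (hm0 : 0 < m)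
    (hm : ¬ p ∣ m) : (T5FrobeniusGenerates.frob hp P) μ = μ ^ p := by
  set ζ : 𝓞 F := ⟨μ, hμ.isIntegral hm0⟩ with hζ
  have hζm : ζ ^ m = 1 := by
    apply Subtype.ext
    simp only [hζ]
    exact hμ.pow_eq_one
  have h := frob_smul_of_pow_eq_one hp P hζm hm
  have h' := congrArg (fun x : 𝓞 F => (x : F)) h
  exact h'

section cyclotomic

variable {n : ℕ} [NeZero n] [IsCyclotomicExtension {n} ℚ F]

include hp in
/-- **«`Frob_p = p` in `(ℤ/n)^×`».**  For the cyclotomic field `F = ℚ(ζ_n)` and a prime `p ∤ n`,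
Mathlib's identification `Gal(F/ℚ) ≃* (ℤ/n)^×` sends the arithmetic Frobenius of any prime `P`
above `p` to the class of `p`. -/
theorem autEquivPow_frob (hpn : ¬ p ∣ n) :
    IsCyclotomicExtension.autEquivPow F (cyclotomic.irreducible_rat (NeZero.pos n))
      (T5FrobeniusGenerates.frob hp P) = ZMod.unitOfCoprime p
        ((Nat.Prime.coprime_iff_not_dvd hp).mpr hpn) := by
  have hζ := IsCyclotomicExtension.zeta_spec n ℚ F
  apply Units.ext
  rw [IsCyclotomicExtension.autEquivPow_apply, ZMod.coe_unitOfCoprime]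
  have hspec := hζ.autToPow_spec ℚ (T5FrobeniusGenerates.frob hp P)
  rw [frob_apply_of_isPrimitiveRoot hp P hζ (NeZero.pos n) hpn] at hspec
  have hfin : IsOfFinOrder (IsCyclotomicExtension.zeta n ℚ F) :=
    isOfFinOrder_iff_pow_eq_one.mpr ⟨n, NeZero.pos n, hζ.pow_eq_one⟩
  have hmod := hfin.pow_eq_pow_iff_modEq.mp hspec
  rw [← hζ.eq_orderOf] at hmod
  have := (ZMod.natCast_eq_natCast_iff _ _ _).mpr hmod
  simpa using this

end cyclotomic

end Summit.Ventures.HodgeRepro2.T5CyclotomicFrobenius
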